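import Literature.NumberTheory.LFunctions.SiegelZeroFormSumAsymptoticLemmaOneProofs
import Literature.NumberTheory.LFunctions.RealZeroSmoothedPerronShift
import HarnessLib

/-!
# Goldfeld–Schinzel 1975, Theorem 1 — discharge of `goldfeldSchinzel1975_theorem1`

D. Goldfeld, A. Schinzel, *On Siegel's zero*, Ann. Scuola Norm. Sup. Pisa (4) **2** (1975)
571–583, Theorem 1 (p. 571) with its proof (§2, pp. 572–577).

We follow the printed proof with Hoffstein's smoothing kernel (`HoffsteinSmoothedPerron.lean`)
in place of `1/(s(s+2)(s+3))`:
* the PERRON side (pp. 576–577, (9)): `Σ_{n ≤ x} r(n) n^{−β} P(n/x) = L(1,χ) x^{1−β}·720 K(1−β) +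
  (720/2π) Re ∫_{Re w = −β} G` at a real zero `β` of `L(s, χ)` (`perron_identity`, from
  `GSPerron.gs_contour_identity` and `Hoffstein1980.integral_hoffG_right_eq`), the integral being
  `O(√D log D · x^{−β})` (`GSPerron.exists_integral_hoffG_line_le`);
* the ARITHMETIC side (Lemma 1, (3)–(5) and (8)): `GoldfeldSchinzel1975.char_core` at `x = ¼√D f²`
  (upper bound, `P ≤ 1`) and at the cutoff `¼√D f` (lower bound, `P(u) ≥ 1 − 15u²`), `f = f(D) =
  (log D/log log D)²`;
* the algebra of p. 577: `1 − β = L(1,χ) x^{1−β} Π(β)/(Σ − E)` with `Π(β) = 720(1−β)K(1−β) =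
  1 + O(1−β)`, `x^{1−β} = 1 + O((1−β) log D)`.

The only deviation from the source is the choice `x = ¼√D f(D)²` (instead of `¼√D f(D)`) with the
lower-bound cutoff at `¼√D f(D)`, which makes the `u`-truncation error of (3) `O(1/f)` without a
separate lemma; all constants are absolute (the threshold `D₀` depends on the absolute constant of
the shifted-line estimate).

## References
- [GoldfeldSchinzel1975] D. Goldfeld, A. Schinzel, *On Siegel's zero*, Ann. SNS Pisa (4) 2 (1975) 571–583, Thm 1, §2.
- [Hoffstein1980SiegelTatuzawa] J. Hoffstein, *On the Siegel–Tatuzawa theorem*, Acta Arith. 38 (1980) 167–174, §2.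
- [MontgomeryVaughan2007] H. L. Montgomery, R. C. Vaughan, *Multiplicative Number Theory I*, CUP 2007, Thm 9.13.
-/

noncomputable section

open Finset Real Complex MeasureTheory DirichletCharacter
open scoped Classical

namespace Literature.NumberTheory.LFunctions

namespace GoldfeldSchinzel1975

open Literature.NumberTheory.LFunctions.Hoffstein1980
open Literature.NumberTheory.LFunctions.GSPerron
open Literature.NumberTheory.LFunctions.RealChar (charDivisorSum charDivisorSum_nonneg
  ofReal_charDivisorSum)
open Literature.NumberTheory.LFunctions.DiscRootCount
open Literature.NumberTheory.QuadraticFields.BinaryQuadraticForm (kroneckerOnePrimes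
  prime_of_mem_kroneckerOnePrimes not_dvd_of_mem_kroneckerOnePrimes
  two_mem_kroneckerOnePrimes_iff jacobiSym_eq_zero_of_prime_dvd
  jacobiSym_eq_one_of_mem_kroneckerOnePrimes jacobiSym_eq_neg_one_of_not_mem_kroneckerOnePrimes)

variable {q : ℕ} [NeZero q] {χ : DirichletCharacter ℂ q}

/-! ### The smoothing weight: `1 − 15u² ≤ P(u) ≤ 1` -/

/-- `P(u) = (1 − u)⁵ (1 + 5u) ≤ 1` on `[0, 1]` (Bernoulli: `1 + 5u ≤ (1 + u)⁵`, and
`(1 − u²)⁵ ≤ 1`). [cite: Hoffstein1980SiegelTatuzawa, §2 proof of Lemma 1 p. 169] -/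
theorem hoffPoly_le_one {u : ℝ} (h0 : 0 ≤ u) (h1 : u ≤ 1) : hoffPoly u ≤ 1 := by
  rw [hoffPoly_eq]
  have hB : 1 + 5 * u ≤ (1 + u) ^ 5 := by
    have := one_add_mul_le_pow (by linarith : (-2 : ℝ) ≤ u) 5
    norm_num at this
    linarith
  have h5 : 0 ≤ (1 - u) ^ 5 := pow_nonneg (by linarith) 5
  calc (1 - u) ^ 5 * (1 + 5 * u) ≤ (1 - u) ^ 5 * (1 + u) ^ 5 :=
        mul_le_mul_of_nonneg_left hB h5
    _ = (1 - u ^ 2) ^ 5 := by ring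
    _ ≤ 1 := pow_le_one₀ (by nlinarith) (by nlinarith)

/-! ### Prime values of a primitive quadratic character (`χ = (D/·)`, `D = χ(−1) q`) -/

/-- For `χ` primitive quadratic modulo `q > 1` and `D = χ(−1)·q`: `χ(p) = 0` for `p ∣ D`,
`χ(p) = 1` for `p ∈ P₁(D)` (the primes with `(D/p) = 1`) and `χ(p) = −1` otherwise — the
dictionary `χ = (D/·)` prime by prime (as in `DiscRootCount.charDivisorSum_eq_sqInd_mul_rho_of_isPrimitive`).
[cite: MontgomeryVaughan2007, Theorem 9.13] -/
theorem primeValues_of_isPrimitive (hq1 : 1 < q) (hprim : χ.IsPrimitive) (hquad : χ.IsQuadratic)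
    {s : ℤ} (hs : χ (-1) = (s : ℂ)) (hs1 : s = 1 ∨ s = -1) :
    (∀ p : ℕ, p.Prime → (p : ℤ) ∣ s * q → χ (p : ZMod q) = 0) ∧
    (∀ p ∈ kroneckerOnePrimes (s * q), χ (p : ZMod q) = 1) ∧
    (∀ p : ℕ, p.Prime → ¬ (p : ℤ) ∣ s * q → p ∉ kroneckerOnePrimes (s * q) →
      χ (p : ZMod q) = -1) := by
  have hfd := PrimitiveQuadratic.isFundamentalDiscriminant_sign_mul hprim hquad hs hs1 hq1
  have h4 := emod_four_of_isFundamental hfd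
  -- values at odd primes: the Legendre symbol `(D/p)`
  have hodd : ∀ p : ℕ, p.Prime → p ≠ 2 → χ (p : ZMod q) = (jacobiSym (s * q) p : ℂ) := by
    intro p hp hp2
    haveI := Fact.mk hp
    rw [PrimitiveQuadratic.apply_prime_eq_legendreSym_sign_mul hprim hquad hs hs1 p hp2,
      jacobiSym.legendreSym.to_jacobiSym]
  -- the prime 2
  have htwo_even : Even q → χ (2 : ZMod q) = 0 := fun he => PrimitiveQuadratic.apply_two_of_even he χ
  have htwo_odd : Odd q → χ (2 : ZMod q) = if (s * q : ℤ) % 8 = 1 then 1 else -1 := fun ho =>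
    PrimitiveQuadratic.apply_two_eq_ite_sign_mul ho hq1 hprim hquad hs hs1
  have hsq : (2 : ℤ) ∣ s * q ↔ Even q := by
    constructor
    · intro h
      have h' : (2 : ℤ) ∣ (q : ℤ) := by
        rcases hs1 with rfl | rfl
        · simpa using h
        · simpa using h
      exact even_iff_two_dvd.mpr (by exact_mod_cast h')
    · rintro ⟨c, hc⟩; exact ⟨s * c, by rw [hc]; push_cast; ring⟩
  refine ⟨?_, ?_, ?_⟩
  · intro p hp hpd
    by_cases hp2 : p = 2
    · subst hp2
      rw [Nat.cast_ofNat]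
      exact htwo_even (hsq.mp hpd)
    · rw [hodd p hp hp2, jacobiSym_eq_zero_of_prime_dvd hp hpd]; simp
  · intro p hP
    have hp := prime_of_mem_kroneckerOnePrimes hP
    by_cases hp2 : p = 2
    · subst hp2
      have h8 := two_mem_kroneckerOnePrimes_iff.mp hP
      have hq_odd : Odd q := by
        rcases Nat.even_or_odd q with he | ho
        · exfalso; exact not_dvd_of_mem_kroneckerOnePrimes hP (by exact_mod_cast hsq.mpr he)
        · exact ho
      rw [Nat.cast_ofNat, htwo_odd hq_odd, if_pos h8]
    · rw [hodd p hp hp2, jacobiSym_eq_one_of_mem_kroneckerOnePrimes h4 hp2 hP]; simp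
  · intro p hp hpd hP
    by_cases hp2 : p = 2
    · subst hp2
      have hq_odd : Odd q := by
        rcases Nat.even_or_odd q with he | ho
        · exfalso; exact hpd (by exact_mod_cast hsq.mpr he)
        · exact ho
      have h8 : ¬ (s * q : ℤ) % 8 = 1 := fun h => hP (two_mem_kroneckerOnePrimes_iff.mpr h)
      rw [Nat.cast_ofNat, htwo_odd hq_odd, if_neg h8]
    · rw [hodd p hp hp2, jacobiSym_eq_neg_one_of_not_mem_kroneckerOnePrimes h4 hp hp2 hpd hP]
      simp

/-- The sign `s = χ(−1) ∈ {±1}` of a quadratic character, and `signedDisc χ = s·q`.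
[cite: GoldfeldSchinzel1975, §1 p. 571] -/
theorem exists_sign (hquad : χ.IsQuadratic) :
    ∃ s : ℤ, (s = 1 ∨ s = -1) ∧ χ (-1) = (s : ℂ) ∧ signedDisc χ = s * (q : ℤ) := by
  by_cases hodd : χ.Odd
  · refine ⟨-1, Or.inr rfl, ?_, ?_⟩
    · have h : χ (-1) = -1 := hodd
      rw [h]; push_cast; ring
    · unfold signedDisc; rw [if_pos hodd]; ring
  · refine ⟨1, Or.inl rfl, ?_, ?_⟩
    · have hne : χ (-1) ≠ 0 := by
        intro h0
        have h := map_mul χ (-1) (-1)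
        rw [h0, mul_zero, show (-1 : ZMod q) * -1 = 1 by ring, map_one] at h
        exact one_ne_zero h
      rcases hquad (-1) with h | h | h
      · exact absurd h hne
      · rw [h]; push_cast; ring
      · exact absurd h hodd
    · unfold signedDisc; rw [if_neg hodd]; ring

/-! ### The Perron side at a real zero: (9) with Hoffstein's kernel -/

/-- **(9), real form.** For `χ` primitive quadratic modulo `q ≥ 3`, a real zero `½ < β < 1` of
`L(s, χ)` and `x ≥ 1`, writing `r = 1 ∗ χ` and `P` for Hoffstein's weight polynomial:
`Σ_{n ≤ x} r(n) n^{−β} P(n/x) = L(1,χ) x^{1−β} · 720/((1−β)(3−β)(4−β)(5−β)(6−β)(7−β))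
  + (720/2π) Re ∫_{Re w = −β} G`
("`I = L(1) x^{1−β}/((1−β)(3−β)(4−β)) + O(x^{−β}√d log d)` … in view of `L(β, χ) = 0`").
[cite: GoldfeldSchinzel1975, §2 proof of Theorem 1 (9) pp. 576–577] -/
theorem perron_identity (hq : 3 ≤ q) (hprim : χ.IsPrimitive) (hq2 : χ ^ 2 = 1) {β : ℝ}
    (hβ0 : 1 / 2 < β) (hβ1 : β < 1) (hLβ : χ.LFunction (β : ℂ) = 0) {x : ℝ} (hx : 1 ≤ x) :
    ∑ n ∈ Ioc 0 ⌊x⌋₊, charDivisorSum χ n * (n : ℝ) ^ (-β) * hoffPoly ((n : ℝ) / x) =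
      (χ.LFunction 1).re * x ^ (1 - β) *
          (720 / ((1 - β) * (3 - β) * (4 - β) * (5 - β) * (6 - β) * (7 - β))) +
        720 / (2 * Real.pi) * (∫ y : ℝ, hoffG χ β x (↑(-β) + y * I)).re := by
  have hq1 : 1 < q := by omega
  have hχ1 : χ ≠ 1 := by
    rintro rfl
    have h : (1 : DirichletCharacter ℂ q).conductor = q := hprim
    rw [DirichletCharacter.conductor_one] at h; omega
  have hx0 : 0 < x := by linarith
  set N : ℕ := ⌊x⌋₊ with hN
  have hxN : x < N + 1 := Nat.lt_floor_add_one x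
  -- the three complex identities
  have hR := integral_hoffG_right_eq χ hβ1 hx0
  rw [tsum_term_mul_hoffWeight_eq_sum (fun n ↦ χ.zetaMul n) β hx0 N hxN] at hR
  have hG := gs_contour_identity hq hprim hβ0 hβ1 hx0
  have hzero : zetaL χ β = 0 := by unfold zetaL; rw [hLβ, mul_zero]
  rw [hzero, zero_div, add_zero, hR] at hG
  -- `Σ = main + E/(2π)` in `ℂ`
  set E : ℂ := ∫ y : ℝ, hoffG χ β x (↑(-β) + y * I) with hE
  set Sc : ℂ := ∑ n ∈ Finset.range (N + 1),
    LSeries.term (fun n ↦ χ.zetaMul n) β n * hoffWeight ((n : ℝ) / x) with hSc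
  have hπ0 : (2 * Real.pi : ℝ) ≠ 0 := by positivity
  have hmainC : χ.LFunction 1 * (x : ℂ) ^ ((1 : ℂ) - β) * hoffKernel ((1 : ℂ) - β) =
      (((χ.LFunction 1).re * x ^ (1 - β) *
        (1 / ((1 - β) * (3 - β) * (4 - β) * (5 - β) * (6 - β) * (7 - β))) : ℝ) : ℂ) := by
    have hL : χ.LFunction 1 = (((χ.LFunction 1).re : ℝ) : ℂ) := by
      apply Complex.ext
      · simp
      · rw [ofReal_im]
        have := DirichletAbel.LFunction_ofReal_im_eq_zero χ hχ1 hq2 (σ := 1) one_pos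
        simpa using this
    have hxc : (x : ℂ) ^ ((1 : ℂ) - β) = (((x ^ (1 - β) : ℝ)) : ℂ) := by
      rw [Complex.ofReal_cpow hx0.le]; push_cast; ring_nf
    have hb1 : (1 : ℝ) - β ≠ 0 := by linarith
    have hb3 : (3 : ℝ) - β ≠ 0 := by linarith
    have hb4 : (4 : ℝ) - β ≠ 0 := by linarith
    have hb5 : (5 : ℝ) - β ≠ 0 := by linarith
    have hb6 : (6 : ℝ) - β ≠ 0 := by linarith
    have hb7 : (7 : ℝ) - β ≠ 0 := by linarith
    have hK : hoffKernel ((1 : ℂ) - β) =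
        (((1 / ((1 - β) * (3 - β) * (4 - β) * (5 - β) * (6 - β) * (7 - β))) : ℝ) : ℂ) := by
      unfold hoffKernel
      have e1 : (1 : ℂ) - β = (((1 - β : ℝ)) : ℂ) := by push_cast; ring
      have hden : (((1 - β : ℝ)) : ℂ) * ((((1 - β : ℝ)) : ℂ) + 2) * ((((1 - β : ℝ)) : ℂ) + 3) *
          ((((1 - β : ℝ)) : ℂ) + 4) * ((((1 - β : ℝ)) : ℂ) + 5) * ((((1 - β : ℝ)) : ℂ) + 6) =
          ((((1 - β) * (3 - β) * (4 - β) * (5 - β) * (6 - β) * (7 - β) : ℝ)) : ℂ) := by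
        push_cast; ring
      rw [e1, hden, ← Complex.ofReal_one, ← Complex.ofReal_div]
    conv_lhs => rw [hL, hxc, hK]
    push_cast; ring
  rw [hmainC] at hG
  -- real parts
  have hre := congrArg Complex.re hG
  have e2π : (2 : ℂ) * (Real.pi : ℂ) = (((2 * Real.pi : ℝ)) : ℂ) := by push_cast; ring
  rw [e2π, Complex.sub_re, Complex.re_ofReal_mul, Complex.re_ofReal_mul, Complex.ofReal_re] at hre
  -- the real part of the smoothed sum
  have hSre : Sc.re = (1 / 720) *
      ∑ n ∈ Ioc 0 N, charDivisorSum χ n * (n : ℝ) ^ (-β) * hoffPoly ((n : ℝ) / x) := by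
    rw [hSc, Complex.re_sum]
    have hsplit : Finset.range (N + 1) = insert 0 (Ioc 0 N) := by
      ext n; simp only [Finset.mem_range, Finset.mem_insert, Finset.mem_Ioc]; omega
    rw [hsplit, Finset.sum_insert (by simp), LSeries.term_zero, zero_mul, Complex.zero_re,
      zero_add, Finset.mul_sum]
    refine Finset.sum_congr rfl fun n hn => ?_
    have hn0 : n ≠ 0 := (Finset.mem_Ioc.mp hn).1.ne'
    have hnx : (n : ℝ) / x ≤ 1 := by
      rw [div_le_one hx0]
      have : (n : ℝ) ≤ N := by exact_mod_cast (Finset.mem_Ioc.mp hn).2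
      exact this.trans (Nat.floor_le hx0.le)
    rw [re_term_mul_hoffWeight hq2 β hn0, ← ofReal_charDivisorSum χ hq2 n, Complex.ofReal_re,
      hoffWeight_of_le_one hnx, Complex.ofReal_re]
    ring
  rw [hSre] at hre
  -- solve for the sum
  have hπ : (0 : ℝ) < 2 * Real.pi := by positivity
  apply mul_left_cancel₀ hπ.ne'
  rw [mul_add, show 2 * Real.pi * (720 / (2 * Real.pi) * E.re) = 720 * E.re by field_simp]
  linear_combination 720 * hre

omit [NeZero q] in
/-- **Upper comparison for the smoothed sum**: `Σ_{n ≤ x} r(n) n^{−β} P(n/x) ≤ x^{1−β} Σ_{n ≤ x} r(n)/n`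
(`P ≤ 1`, `n^{−β} = n^{1−β}/n ≤ x^{1−β}/n`). [cite: GoldfeldSchinzel1975, §2 proof of Theorem 1 (8) p. 576] -/
theorem smoothed_sum_le (hq2 : χ ^ 2 = 1) {β : ℝ} (hβ1 : β ≤ 1) {x : ℝ} (hx : 1 ≤ x) :
    ∑ n ∈ Ioc 0 ⌊x⌋₊, charDivisorSum χ n * (n : ℝ) ^ (-β) * hoffPoly ((n : ℝ) / x) ≤
      x ^ (1 - β) * ∑ n ∈ Ioc 0 ⌊x⌋₊, charDivisorSum χ n / (n : ℝ) := by
  have hx0 : 0 < x := by linarith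
  rw [Finset.mul_sum]
  refine Finset.sum_le_sum fun n hn => ?_
  have hn1 : 1 ≤ n := (Finset.mem_Ioc.mp hn).1
  have hn0 : (0 : ℝ) < n := by exact_mod_cast hn1
  have hnx' : (n : ℝ) ≤ x :=
    le_trans (by exact_mod_cast (Finset.mem_Ioc.mp hn).2) (Nat.floor_le hx0.le)
  have hnx : (n : ℝ) / x ≤ 1 := by rwa [div_le_one hx0]
  have hr := charDivisorSum_nonneg χ hq2 n
  have hP1 := hoffPoly_le_one (by positivity : 0 ≤ (n : ℝ) / x) hnx
  have hP0 := hoffPoly_nonneg (by positivity : 0 ≤ (n : ℝ) / x) hnx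
  -- `n^{−β} ≤ x^{1−β}/n`
  have hpow : (n : ℝ) ^ (-β) ≤ x ^ (1 - β) / n := by
    rw [show -β = (1 - β) + (-1 : ℝ) by ring, Real.rpow_add hn0, Real.rpow_neg_one, ← div_eq_mul_inv]
    exact div_le_div_of_nonneg_right (Real.rpow_le_rpow hn0.le hnx' (by linarith)) hn0.le
  calc charDivisorSum χ n * (n : ℝ) ^ (-β) * hoffPoly ((n : ℝ) / x)
      ≤ charDivisorSum χ n * (x ^ (1 - β) / n) * 1 := by gcongr
    _ = x ^ (1 - β) * (charDivisorSum χ n / (n : ℝ)) := by ring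

omit [NeZero q] in
/-- **Lower comparison for the smoothed sum**: for `N' ≤ ⌊x⌋` and `θ` with `15 (n/x)² ≤ θ` for
`n ≤ N'`: `(1 − θ) Σ_{n ≤ N'} r(n)/n ≤ Σ_{n ≤ x} r(n) n^{−β} P(n/x)` (`P(u) ≥ 1 − 15u²`,
`n^{−β} ≥ 1/n`, `r ≥ 0`). [cite: GoldfeldSchinzel1975, §2 proof of Theorem 1 (8) p. 576] -/
theorem le_smoothed_sum (hq2 : χ ^ 2 = 1) {β : ℝ} (hβ1 : β ≤ 1) {x : ℝ} (hx : 1 ≤ x) {N' : ℕ}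
    (hN' : N' ≤ ⌊x⌋₊) {θ : ℝ} (hθ : ∀ n ∈ Ioc 0 N', 15 * ((n : ℝ) / x) ^ 2 ≤ θ) :
    (1 - θ) * ∑ n ∈ Ioc 0 N', charDivisorSum χ n / (n : ℝ) ≤
      ∑ n ∈ Ioc 0 ⌊x⌋₊, charDivisorSum χ n * (n : ℝ) ^ (-β) * hoffPoly ((n : ℝ) / x) := by
  have hx0 : 0 < x := by linarith
  have hterm_nonneg : ∀ n ∈ Ioc 0 ⌊x⌋₊,
      0 ≤ charDivisorSum χ n * (n : ℝ) ^ (-β) * hoffPoly ((n : ℝ) / x) := by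
    intro n hn
    have hnx : (n : ℝ) / x ≤ 1 := by
      rw [div_le_one hx0]
      exact le_trans (by exact_mod_cast (Finset.mem_Ioc.mp hn).2) (Nat.floor_le hx0.le)
    exact mul_nonneg (mul_nonneg (charDivisorSum_nonneg χ hq2 n) (Real.rpow_nonneg (Nat.cast_nonneg n) _))
      (hoffPoly_nonneg (by positivity) hnx)
  calc (1 - θ) * ∑ n ∈ Ioc 0 N', charDivisorSum χ n / (n : ℝ)
      = ∑ n ∈ Ioc 0 N', (1 - θ) * (charDivisorSum χ n / (n : ℝ)) := Finset.mul_sum _ _ _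
    _ ≤ ∑ n ∈ Ioc 0 N', charDivisorSum χ n * (n : ℝ) ^ (-β) * hoffPoly ((n : ℝ) / x) := by
        refine Finset.sum_le_sum fun n hn => ?_
        have hn1 : 1 ≤ n := (Finset.mem_Ioc.mp hn).1
        have hn0 : (0 : ℝ) < n := by exact_mod_cast hn1
        have hn1r : (1 : ℝ) ≤ n := by exact_mod_cast hn1
        have hnN : n ≤ ⌊x⌋₊ := (Finset.mem_Ioc.mp hn).2.trans hN'
        have hnx : (n : ℝ) / x ≤ 1 := by
          rw [div_le_one hx0]; exact le_trans (by exact_mod_cast hnN) (Nat.floor_le hx0.le)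
        have hr := charDivisorSum_nonneg χ hq2 n
        have hP := one_sub_le_hoffPoly (by positivity : 0 ≤ (n : ℝ) / x) hnx
        have hθn := hθ n hn
        have hpow : 1 / (n : ℝ) ≤ (n : ℝ) ^ (-β) := by
          rw [one_div, ← Real.rpow_neg_one]
          exact Real.rpow_le_rpow_of_exponent_le hn1r (by linarith)
        calc (1 - θ) * (charDivisorSum χ n / (n : ℝ))
            = charDivisorSum χ n * (1 / n) * (1 - θ) := by ring
          _ ≤ charDivisorSum χ n * (1 / n) * hoffPoly ((n : ℝ) / x) := by
              refine mul_le_mul_of_nonneg_left (by linarith) (by positivity)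
          _ ≤ charDivisorSum χ n * (n : ℝ) ^ (-β) * hoffPoly ((n : ℝ) / x) := by
              refine mul_le_mul_of_nonneg_right (mul_le_mul_of_nonneg_left hpow hr)
                (hoffPoly_nonneg (by positivity) hnx)
    _ ≤ ∑ n ∈ Ioc 0 ⌊x⌋₊, charDivisorSum χ n * (n : ℝ) ^ (-β) * hoffPoly ((n : ℝ) / x) :=
        Finset.sum_le_sum_of_subset_of_nonneg (Finset.Ioc_subset_Ioc_right hN')
          fun n hn _ => hterm_nonneg n hn

/-! ### The algebra of p. 577 -/

/-- **Lower bound for `Σ − E`**: from `Σ ≥ (1 − θ) Σ_{n ≤ x'} r(n)/n ≥ (1 − θ)(π²/6 − V')Σ'` and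
`|E| ≤ ε`: `(π²/6) Σ' (1 − (V' + θ + ε)) ≤ Σ − E`. [cite: GoldfeldSchinzel1975, §2 proof of Theorem 1 p. 577] -/
theorem main_lower {SP L' Er εE FS c θ V' : ℝ} (hSP : (1 - θ) * L' ≤ SP) (hL' : (c - V') * FS ≤ L')
    (hEr : |Er| ≤ εE) (hFS : 1 ≤ FS) (hc : 1 ≤ c) (hθ0 : 0 ≤ θ) (hθ1 : θ ≤ 1) (hV' : 0 ≤ V') :
    c * FS * (1 - (V' + θ + εE)) ≤ SP - Er := by
  have hFS0 : 0 ≤ FS := by linarith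
  have h1 : (1 - θ) * ((c - V') * FS) ≤ (1 - θ) * L' := mul_le_mul_of_nonneg_left hL' (by linarith)
  have hp1 : 0 ≤ θ * (V' * FS) := mul_nonneg hθ0 (mul_nonneg hV' hFS0)
  have hp2 : V' * FS ≤ V' * (c * FS) := mul_le_mul_of_nonneg_left (by nlinarith) hV'
  have hε0 : 0 ≤ εE := (abs_nonneg _).trans hEr
  have hp3 : εE ≤ εE * (c * FS) := le_mul_of_one_le_right hε0 (by nlinarith)
  have hEr' : Er ≤ εE := (le_abs_self _).trans hEr
  have hp4 : 0 ≤ θ * (c * FS) - θ * (c * FS) := by linarith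
  nlinarith [h1, hp1, hp2, hp3, hEr', mul_nonneg hθ0 (mul_nonneg (by linarith : (0:ℝ) ≤ c) hFS0)]

/-- **Upper bound for `Σ − E`**: from `Σ ≤ x^{1−β} Σ_{n ≤ x} r(n)/n ≤ x^{1−β}(π²/6)(Σ'(1+2W)+R)`
and `|E| ≤ ε`: `Σ − E ≤ x^{1−β}(π²/6)Σ'(1 + 2W + R + ε)`. [cite: GoldfeldSchinzel1975, §2 proof of Theorem 1 p. 577] -/
theorem main_upper {SP U Er εE FS c W R xr : ℝ} (hSP : SP ≤ xr * U)
    (hU : U ≤ c * (FS * (1 + 2 * W) + R)) (hEr : |Er| ≤ εE) (hFS : 1 ≤ FS) (hxr : 1 ≤ xr)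
    (hc : 1 ≤ c) (hR : 0 ≤ R) :
    SP - Er ≤ xr * (c * FS) * (1 + (2 * W + R + εE)) := by
  have hε0 : 0 ≤ εE := (abs_nonneg _).trans hEr
  have h1 : xr * U ≤ xr * (c * (FS * (1 + 2 * W) + R)) := mul_le_mul_of_nonneg_left hU (by linarith)
  have h2 : R ≤ FS * R := le_mul_of_one_le_left hR hFS
  have h3 : xr * c * R ≤ xr * c * (FS * R) := mul_le_mul_of_nonneg_left h2 (by nlinarith)
  have h4 : εE ≤ xr * c * FS * εE := by
    refine le_mul_of_one_le_left hε0 ?_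
    have : 1 ≤ xr * c := by nlinarith
    nlinarith
  have hEr' : -Er ≤ εE := (neg_le_abs _).trans hEr
  nlinarith [h1, h3, h4, hEr']

/-- **Solving for `1 − β`** ("`1 − β = (6/π²)(L(1)/Σ') x^{1−β}/((3−β)(4−β)) · (1 + O(…))`"): from
`(1−β)(Σ − E) = L(1) x^{1−β} Π`, `cΣ'(1−δ₁) ≤ Σ − E ≤ x^{1−β} cΣ'(1+δ₂)`, `1 − 6(1−β) ≤ Π ≤ 1`,
`1 ≤ x^{1−β} ≤ 1 + 2(1−β) log x`:
`|(1−β) − L(1)/(cΣ')| ≤ (L(1)/(cΣ'))(2(1−β)log x + 6δ₁ + 6(1−β) + 6δ₂)`.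
[cite: GoldfeldSchinzel1975, §2 proof of Theorem 1 p. 577] -/
theorem main_algebra {t L1 xr Pf Q cFS δ₁ δ₂ tl : ℝ} (ht : 0 < t) (hcFS : 0 < cFS) (hPf0 : 0 < Pf)
    (hPf1 : Pf ≤ 1) (hPf2 : 1 - 6 * t ≤ Pf) (hxr1 : 1 ≤ xr) (hxr2 : xr ≤ 1 + 2 * tl) (htl0 : 0 ≤ tl)
    (htl1 : tl ≤ 1) (hδ₁ : δ₁ ≤ 1 / 2) (hδ₁0 : 0 ≤ δ₁) (hδ₂0 : 0 ≤ δ₂)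
    (hQ : t * Q = L1 * xr * Pf) (hQlo : cFS * (1 - δ₁) ≤ Q) (hQhi : Q ≤ xr * cFS * (1 + δ₂)) :
    |t - L1 / cFS| ≤ L1 / cFS * (2 * tl + 6 * δ₁ + 6 * t + 6 * δ₂) := by
  have hQ0 : 0 < Q := lt_of_lt_of_le (by nlinarith) hQlo
  have hprod : 0 < L1 * (xr * Pf) := by rw [← mul_assoc, ← hQ]; exact mul_pos ht hQ0
  have hL1 : 0 < L1 := (mul_pos_iff_of_pos_right (mul_pos (by linarith) hPf0)).mp hprod
  set m := L1 / cFS with hm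
  have hm0 : 0 < m := div_pos hL1 hcFS
  have hL1m : L1 = m * cFS := by rw [hm]; field_simp
  -- upper: `t cFS (1 − δ₁) ≤ tQ = L1 xr Pf ≤ L1 (1 + 2 tl)`
  have hup1 : t * (cFS * (1 - δ₁)) ≤ L1 * (1 + 2 * tl) := by
    have h1 : t * (cFS * (1 - δ₁)) ≤ t * Q := mul_le_mul_of_nonneg_left hQlo ht.le
    have h2 : L1 * xr * Pf ≤ L1 * xr := mul_le_of_le_one_right (by nlinarith) hPf1
    have h3 : L1 * xr ≤ L1 * (1 + 2 * tl) := mul_le_mul_of_nonneg_left hxr2 hL1.le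
    linarith [hQ]
  have hup2 : L1 * (1 + 2 * tl) ≤ L1 * ((1 - δ₁) * (1 + 2 * tl + 6 * δ₁)) := by
    refine mul_le_mul_of_nonneg_left ?_ hL1.le
    nlinarith
  have hup : t ≤ m * (1 + 2 * tl + 6 * δ₁) := by
    have h : t * (cFS * (1 - δ₁)) ≤ (m * (1 + 2 * tl + 6 * δ₁)) * (cFS * (1 - δ₁)) := by
      calc t * (cFS * (1 - δ₁)) ≤ L1 * ((1 - δ₁) * (1 + 2 * tl + 6 * δ₁)) := hup1.trans hup2
        _ = (m * (1 + 2 * tl + 6 * δ₁)) * (cFS * (1 - δ₁)) := by rw [hL1m]; ring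
    exact le_of_mul_le_mul_right h (by nlinarith)
  -- lower: `L1 xr (1 − 6t) ≤ L1 xr Pf = tQ ≤ t xr cFS (1 + δ₂)`
  have hlow1 : L1 * (1 - 6 * t) ≤ t * cFS * (1 + δ₂) := by
    have h1 : L1 * xr * (1 - 6 * t) ≤ L1 * xr * Pf := mul_le_mul_of_nonneg_left hPf2 (by nlinarith)
    have h2 : t * Q ≤ t * (xr * cFS * (1 + δ₂)) := mul_le_mul_of_nonneg_left hQhi ht.le
    have h3 : xr * (L1 * (1 - 6 * t)) ≤ xr * (t * cFS * (1 + δ₂)) := by nlinarith [hQ]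
    exact le_of_mul_le_mul_left h3 (by linarith)
  have hlow : m * (1 - 6 * t) ≤ t * (1 + δ₂) := by
    have h : (m * (1 - 6 * t)) * cFS ≤ (t * (1 + δ₂)) * cFS := by
      calc (m * (1 - 6 * t)) * cFS = L1 * (1 - 6 * t) := by rw [hL1m]; ring
        _ ≤ t * cFS * (1 + δ₂) := hlow1
        _ = (t * (1 + δ₂)) * cFS := by ring
    exact le_of_mul_le_mul_right h hcFS
  have ht6 : t ≤ 6 * m := by nlinarith
  have htδ : t * δ₂ ≤ 6 * m * δ₂ := mul_le_mul_of_nonneg_right ht6 hδ₂0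
  rw [abs_le]
  constructor
  · nlinarith [mul_nonneg hm0.le htl0, mul_nonneg hm0.le hδ₁0]
  · nlinarith [mul_nonneg hm0.le ht.le, mul_nonneg hm0.le hδ₂0]

/-- `Π(β) = 720/((3−β)(4−β)(5−β)(6−β)(7−β)) ∈ [1 − 6(1−β), 1]` for `0 < 1 − β ≤ 1/20`
(the factor `1/((3−β)(4−β))·(…) = 1 + O(1−β)` of p. 577). [cite: GoldfeldSchinzel1975, §2 proof of Theorem 1 p. 577] -/
theorem pi_factor_bounds {t : ℝ} (ht0 : 0 ≤ t) (ht : t ≤ 1 / 20) :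
    720 / ((2 + t) * (3 + t) * (4 + t) * (5 + t) * (6 + t)) ≤ 1 ∧
      1 - 6 * t ≤ 720 / ((2 + t) * (3 + t) * (4 + t) * (5 + t) * (6 + t)) := by
  have hP : 720 ≤ (2 + t) * (3 + t) * (4 + t) * (5 + t) * (6 + t) := by
    have h2 : (2 : ℝ) ≤ 2 + t := by linarith
    have h3 : (3 : ℝ) ≤ 3 + t := by linarith
    have h4 : (4 : ℝ) ≤ 4 + t := by linarith
    have h5 : (5 : ℝ) ≤ 5 + t := by linarith
    have h6 : (6 : ℝ) ≤ 6 + t := by linarith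
    calc (720 : ℝ) = 2 * 3 * 4 * 5 * 6 := by norm_num
      _ ≤ _ := by gcongr
  have hP0 : 0 < (2 + t) * (3 + t) * (4 + t) * (5 + t) * (6 + t) := by positivity
  refine ⟨by rw [div_le_one hP0]; exact hP, ?_⟩
  rw [le_div_iff₀ hP0]
  -- `(1 − 6t)·Π(j + t) ≤ (1 − 6t)(1 + t)⁵·720 ≤ 720`
  have hQ : (2 + t) * (3 + t) * (4 + t) * (5 + t) * (6 + t) ≤ 720 * (1 + t) ^ 5 := by
    have h2 : 2 + t ≤ 2 * (1 + t) := by linarith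
    have h3 : 3 + t ≤ 3 * (1 + t) := by linarith
    have h4 : 4 + t ≤ 4 * (1 + t) := by linarith
    have h5 : 5 + t ≤ 5 * (1 + t) := by linarith
    have h6 : 6 + t ≤ 6 * (1 + t) := by linarith
    calc (2 + t) * (3 + t) * (4 + t) * (5 + t) * (6 + t)
        ≤ (2 * (1 + t)) * (3 * (1 + t)) * (4 * (1 + t)) * (5 * (1 + t)) * (6 * (1 + t)) := by
          gcongr
      _ = 720 * (1 + t) ^ 5 := by ring
  have hB : (1 + t) ^ 5 ≤ 1 + 6 * t := by nlinarith [pow_nonneg ht0 2, pow_nonneg ht0 3]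
  rcases le_or_gt (1 - 6 * t) 0 with h | h
  · nlinarith
  · calc (1 - 6 * t) * ((2 + t) * (3 + t) * (4 + t) * (5 + t) * (6 + t))
        ≤ (1 - 6 * t) * (720 * (1 + t) ^ 5) := mul_le_mul_of_nonneg_left hQ h.le
      _ ≤ (1 - 6 * t) * (720 * (1 + 6 * t)) := by
          refine mul_le_mul_of_nonneg_left ?_ h.le; linarith
      _ = 720 * (1 - 36 * t ^ 2) := by ring
      _ ≤ 720 := by nlinarith [sq_nonneg t]

/-- **The numerical side conditions of Theorem 1** (all `≪ (log log D)²/log D`): with `L = log D`,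
`u = log L ≥ max(100, 48(3 + 4320 C_E))`, `s = L/u`: `15/s⁴ ≤ u²/L`, the shifted-line error
`(720/2π)·C_E·4e(2L+1)/s⁴ ≤ 4320 C_E u²/L`, `(3 + 4320 C_E) u²/L ≤ ½`, `1/L ≤ 1/20`.
[cite: GoldfeldSchinzel1975, §2 proof of Theorem 1 p. 577] -/
theorem theorem1_numerics {u Lr s CE : ℝ} (hu : 100 ≤ u) (hCE : 0 < CE)
    (huC : 48 * (3 + 4320 * CE) ≤ u) (hLu : 32 * u ^ 2 ≤ Lr) (hLexp : Lr = Real.exp u)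
    (hs : s = Lr / u) :
    15 / s ^ 4 ≤ u ^ 2 / Lr ∧
    720 / (2 * Real.pi) * (CE * (4 * Real.exp 1 * (2 * Lr + 1) / s ^ 4)) ≤
      4320 * CE * (u ^ 2 / Lr) ∧
    (3 + 4320 * CE) * (u ^ 2 / Lr) ≤ 1 / 2 ∧ 1 / Lr ≤ 1 / 20 ∧ 1 ≤ Lr := by
  have hu0 : 0 < u := by linarith
  have hLr0 : 0 < Lr := by nlinarith
  have huL : u ≤ Lr := by nlinarith
  have hs0 : 0 < s := by rw [hs]; positivity
  have hs1 : 1 ≤ s := by rw [hs, le_div_iff₀ hu0]; linarith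
  have hquot : u ^ 2 / Lr ≤ 24 / u ^ 2 := by
    have h := Real.pow_div_factorial_le_exp u hu0.le 4
    have h4 : ((Nat.factorial 4 : ℕ) : ℝ) = 24 := by norm_num [Nat.factorial]
    rw [h4, ← hLexp] at h
    rw [div_le_div_iff₀ hLr0 (by positivity)]
    nlinarith
  refine ⟨?_, ?_, ?_, ?_, ?_⟩
  · -- `15/s⁴ ≤ 15/s² = 15u²/L² ≤ u²/L`
    have h1 : 15 / s ^ 4 ≤ 15 / s ^ 2 :=
      div_le_div_of_nonneg_left (by norm_num) (by positivity)
        (pow_le_pow_right₀ hs1 (by norm_num))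
    have h2 : 15 / s ^ 2 = 15 * u ^ 2 / Lr ^ 2 := by rw [hs]; field_simp
    have h3 : 15 * u ^ 2 / Lr ^ 2 ≤ u ^ 2 / Lr := by
      rw [div_le_div_iff₀ (by positivity) hLr0]
      have : 15 * Lr ≤ Lr ^ 2 := by nlinarith
      nlinarith [sq_nonneg u]
    linarith
  · have hπ : 720 / (2 * Real.pi) ≤ 120 := by
      rw [div_le_iff₀ (by positivity)]; nlinarith [Real.pi_gt_three]
    have he : 4 * Real.exp 1 ≤ 12 := by have := Real.exp_one_lt_d9; linarith
    have hfrac : (2 * Lr + 1) / s ^ 4 ≤ 3 * (u ^ 2 / Lr) := by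
      rw [hs, div_pow, div_div_eq_mul_div, div_le_iff₀ (by positivity)]
      have e : 3 * (u ^ 2 / Lr) * Lr ^ 4 = 3 * u ^ 2 * Lr ^ 3 := by field_simp
      rw [e]
      have hu2L : u ^ 2 ≤ Lr ^ 2 := pow_le_pow_left₀ hu0.le huL 2
      have h3L : 2 * Lr + 1 ≤ 3 * Lr := by linarith
      calc (2 * Lr + 1) * u ^ 4 = (2 * Lr + 1) * u ^ 2 * u ^ 2 := by ring
        _ ≤ (3 * Lr) * u ^ 2 * Lr ^ 2 := by gcongr
        _ = 3 * u ^ 2 * Lr ^ 3 := by ring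
    calc 720 / (2 * Real.pi) * (CE * (4 * Real.exp 1 * (2 * Lr + 1) / s ^ 4))
        = 720 / (2 * Real.pi) * (CE * ((4 * Real.exp 1) * ((2 * Lr + 1) / s ^ 4))) := by ring
      _ ≤ 120 * (CE * (12 * (3 * (u ^ 2 / Lr)))) := by
          gcongr
      _ = 4320 * CE * (u ^ 2 / Lr) := by ring
  · have hB : 48 * (3 + 4320 * CE) ≤ u ^ 2 := by nlinarith
    calc (3 + 4320 * CE) * (u ^ 2 / Lr) ≤ (3 + 4320 * CE) * (24 / u ^ 2) :=
          mul_le_mul_of_nonneg_left hquot (by positivity)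
      _ ≤ 1 / 2 := by
          rw [← mul_div_assoc, div_le_iff₀ (by positivity)]; nlinarith
  · exact div_le_div_of_nonneg_left (by norm_num) (by norm_num) (by nlinarith)
  · nlinarith

/-- `log log D ≥ u₀` once `D ≥ ⌈exp(exp u₀)⌉`. [cite: GoldfeldSchinzel1975, §2 Lemma 1 p. 572] -/
theorem loglog_ge {u₀ : ℝ} {Δ : ℕ} (hD : ⌈Real.exp (Real.exp u₀)⌉₊ ≤ Δ) :
    u₀ ≤ Real.log (Real.log (Δ : ℝ)) := by
  have hΔr : Real.exp (Real.exp u₀) ≤ (Δ : ℝ) := le_trans (Nat.le_ceil _) (by exact_mod_cast hD)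
  have hΔ0 : (0 : ℝ) < Δ := lt_of_lt_of_le (Real.exp_pos _) hΔr
  have h1 : Real.exp u₀ ≤ Real.log (Δ : ℝ) := (Real.le_log_iff_exp_le hΔ0).mpr hΔr
  have h0 : 0 < Real.log (Δ : ℝ) := lt_of_lt_of_le (Real.exp_pos _) h1
  exact (Real.le_log_iff_exp_le h0).mpr h1

end GoldfeldSchinzel1975

/-! ### Theorem 1 -/

open GoldfeldSchinzel1975 Hoffstein1980 GSPerron DiscRootCount in
open Literature.NumberTheory.LFunctions.RealChar (charDivisorSum charDivisorSum_nonneg) in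
open Literature.NumberTheory.LFunctions.Mertens (meisselMertens) in
open Literature.NumberTheory.Sieve (RankinComposed.C₀) in
/-- **Goldfeld–Schinzel 1975, Theorem 1** (discharge of `goldfeldSchinzel1975_theorem1`): for a
primitive quadratic `χ` mod `D > D₀` (`d = χ(−1) D` the fundamental discriminant with
`χ = (d/·)`) and a real zero `β ∈ (1 − 1/log D, 1)` of `L(s, χ)`,
`|(1 − β) − (6/π²) L(1,χ)/Σ' 1/a| ≤ (6/π²)(L(1,χ)/Σ' 1/a) · C · ((log log D)²/log D + (1 − β) log D)`
with an absolute `C` (`c₁ = 1`). [cite: GoldfeldSchinzel1975, Theorem 1 p. 571; proof §2 pp. 572–577] -/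
theorem goldfeldSchinzel1975_theorem1_holds : goldfeldSchinzel1975_theorem1 := by
  obtain ⟨CE, hCE, hEb⟩ := GSPerron.exists_integral_hoffG_line_le
  refine ⟨1, one_pos, 12 * (163 + Real.exp (2 * (meisselMertens + 8 / Real.log 16 + 3 +
    24 * Real.exp 1 + RankinComposed.C₀)) + 4320 * CE) + 8,
    ⌈Real.exp (Real.exp (100 + 48 * (3 + 4320 * CE)))⌉₊, ?_⟩
  intro D _ hD₀ χ hquad hprim β hβlo hβ1 hLβ
  have hq2 : χ ^ 2 = 1 := MulChar.isQuadratic_iff_sq_eq_one.mp hquad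
  obtain ⟨sg, hsg1, hsg, hsd⟩ := exists_sign hquad
  -- thresholds
  have huC0 : 0 ≤ 48 * (3 + 4320 * CE) := by positivity
  have hD₀' : ⌈Real.exp (Real.exp 100)⌉₊ ≤ D :=
    le_trans (Nat.ceil_mono (Real.exp_le_exp.mpr (Real.exp_le_exp.mpr (by linarith)))) hD₀
  have huC := loglog_ge hD₀
  obtain ⟨hLr0, hu100, hLexp, hLu, hΔ17, hA1, hlogA, hxD⟩ := sizes hD₀'
  have hD3 : 3 ≤ D := le_trans (by norm_num) hΔ17
  have hD1 : 1 < D := lt_of_lt_of_le (by norm_num) hΔ17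
  have hfd := PrimitiveQuadratic.isFundamentalDiscriminant_sign_mul hprim hquad hsg hsg1 hD1
  obtain ⟨h0, h1, h2⟩ := primeValues_of_isPrimitive hD1 hprim hquad hsg hsg1
  have hnat : (sg * (D : ℤ)).natAbs = D := by
    rcases hsg1 with h | h <;> simp [h]
  have hcc := char_core hfd χ hq2 h0 h1 h2
  simp only [hnat] at hcc
  obtain ⟨hMA, hAM⟩ := sqrt_window D (le_trans (by norm_num) hΔ17)
  have hEb' := fun (hb : 1 / 2 ≤ β) (x : ℝ) (hx : 0 < x) => hEb hD3 hprim hb hβ1 hx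
  clear hEb
  have hsqrtD : 0 < Real.sqrt (D : ℝ) :=
    Real.sqrt_pos.mpr (by exact_mod_cast lt_of_lt_of_le (by norm_num) hΔ17)
  rw [hsd]
  -- names
  set K₀ : ℝ := meisselMertens + 8 / Real.log 16 + 3 + 24 * Real.exp 1 + RankinComposed.C₀
    with hK₀
  set Lr : ℝ := Real.log (D : ℝ) with hLr
  set u : ℝ := Real.log Lr with hu
  set A : ℝ := Real.sqrt (D : ℝ) / 4 with hA
  set s : ℝ := Lr / u with hs
  set M : ℕ := Nat.sqrt ((D - 1) / 16) with hM
  set E : ℝ := Real.exp (Lr / (8 * u)) with hE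
  set l : ℕ := ⌈E⌉₊ with hl
  set x : ℝ := A * s ^ 4 with hx
  set x' : ℝ := A * s ^ 2 with hx'
  set FS : ℝ := formSum (sg * (D : ℤ)) with hFS
  -- parameters
  obtain ⟨hs4, hl16, hlE, hlE', hx'Z₀, hxx'₀, hx'Ms₀, hxMs₀, hxl₀, h2s⟩ :=
    parameters hu100 hLu hLexp hs hE hl hA1 hMA hAM
  have hx'Z : (M : ℝ) + 1 ≤ x' := hx'Z₀
  have hxx' : x' ≤ x := hxx'₀
  have hx'Ms : x' ≤ ((M : ℝ) + 1) * s ^ 2 := hx'Ms₀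
  have hxMs : x ≤ ((M : ℝ) + 1) * s ^ 4 := hxMs₀
  have hxl : x ≤ l * ((M : ℝ) + 1) := hxl₀
  have hxZ : (M : ℝ) + 1 ≤ x := hx'Z.trans hxx'
  have hx'l : x' ≤ l * ((M : ℝ) + 1) := hxx'.trans hxl
  have hM0r : (0 : ℝ) ≤ (M : ℝ) := Nat.cast_nonneg M
  have hM1r : (0 : ℝ) < (M : ℝ) + 1 := by linarith only [hM0r]
  have hx1 : 1 ≤ x := by linarith only [hxZ, hM0r]
  have hx'1 : 1 ≤ x' := by linarith only [hx'Z, hM0r]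
  have hx0 : 0 < x := by linarith only [hx1]
  have hA0 : 0 < A := by linarith only [hA1]
  have hs0 : 0 < s := by linarith only [hs4]
  have hsne : s ≠ 0 := hs0.ne'
  have hsqne : Real.sqrt (D : ℝ) ≠ 0 := hsqrtD.ne'
  have hu0 : 0 < u := by linarith only [hu100]
  have hq0 : 0 ≤ u ^ 2 / Lr := by positivity
  have hM0 : 0 < M :=
    hM ▸ Nat.sqrt_pos.mpr (Nat.div_pos (Nat.le_sub_of_add_le hΔ17) (by norm_num))
  obtain ⟨h15, hεnum, hδhalf, hLr20, hLr1⟩ := theorem1_numerics hu100 hCE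
    (le_trans (by linarith only [huC0]) huC) hLu hLexp hs
  -- `β`
  have ht0 : 0 < 1 - β := sub_pos.mpr hβ1
  have htinv : 1 - β < 1 / Lr := by linarith only [hβlo]
  have htL : (1 - β) * Lr < 1 := (lt_div_iff₀ hLr0).mp htinv
  have ht20 : 1 - β ≤ 1 / 20 := by linarith only [htinv, hLr20]
  have hβ0 : 1 / 2 < β := by linarith only [htinv, hLr20]
  -- the two core estimates
  obtain ⟨hFS1, hupX, -⟩ := hcc hΔ17 hl16 hxZ hxl
  obtain ⟨-, -, hlowX'⟩ := hcc hΔ17 hl16 hx'Z hx'l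
  have hFS0 : 0 < FS := by linarith only [hFS1]
  have hFSne : FS ≠ 0 := hFS0.ne'
  -- the error terms `W`, `R`, `V'`
  obtain ⟨hWpos, hW⟩ := window_bound hu100 hLu hLexp (w := 2 * x / ((M : ℝ) + 1))
    (div_pos (by linarith only [hx0]) hM1r)
    (by rw [div_le_iff₀ hM1r]; linarith only [hxMs]) hlE
  have hR := remainder_bound (K₀ := K₀) hu100 hLu hLexp hM1r
    (hlogA ▸ Real.log_le_log hA0 hAM) hlE hlE'
  have hV' := (inv_sqrt_bound hA0 hMA hM0 hx' (by linarith only [hs4])).trans h2s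
  have hW0 : 0 ≤ (Real.log (2 * x / ((M : ℝ) + 1)) + 16) / Real.log ((l : ℝ) / 2) := by
    refine div_nonneg ?_ hWpos.le
    have : 0 ≤ Real.log (2 * x / ((M : ℝ) + 1)) :=
      Real.log_nonneg (by rw [le_div_iff₀ hM1r]; linarith only [hxZ])
    linarith only [this]
  have hR0 : 0 ≤ ((M : ℝ) + 1) ^ (-(1 / Real.log l)) *
      Real.exp (2 * (Real.log (Real.log l) + K₀)) :=
    mul_nonneg (Real.rpow_nonneg hM1r.le _) (Real.exp_pos _).le
  have hV'0 : 0 ≤ 1 / (Nat.sqrt (⌊x'⌋₊ / M) : ℝ) := by positivity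
  have heq0 : 0 ≤ Real.exp (2 * K₀) * (u ^ 2 / Lr) := by positivity
  have hRu : Real.exp (2 * K₀) / Lr ≤ Real.exp (2 * K₀) * (u ^ 2 / Lr) := by
    rw [div_eq_mul_one_div]
    refine mul_le_mul_of_nonneg_left (div_le_div_of_nonneg_right ?_ hLr0.le) (Real.exp_pos _).le
    exact one_le_pow₀ (by linarith only [hu100])
  -- the Perron side
  have hP := perron_identity hD3 hprim hq2 hβ0 hβ1 hLβ hx1
  have hEn := hEb' hβ0.le x hx0
  have hSPle := smoothed_sum_le (χ := χ) hq2 hβ1.le hx1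
  have hN'N : ⌊x'⌋₊ ≤ ⌊x⌋₊ := Nat.floor_le_floor hxx'
  have hSPge := le_smoothed_sum (χ := χ) hq2 hβ1.le hx1 hN'N (θ := 15 / s ^ 4) (by
    intro n hn
    have hn : (n : ℝ) ≤ x' := le_trans (by exact_mod_cast (Finset.mem_Ioc.mp hn).2)
      (Nat.floor_le (by linarith only [hx'1]))
    have h1 : (n : ℝ) / x ≤ 1 / s ^ 2 := by
      rw [div_le_div_iff₀ hx0 (by positivity), one_mul, hx]
      calc (n : ℝ) * s ^ 2 ≤ x' * s ^ 2 := mul_le_mul_of_nonneg_right hn (by positivity)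
        _ = A * s ^ 4 := by rw [hx']; ring
    have h2 : ((n : ℝ) / x) ^ 2 ≤ (1 / s ^ 2) ^ 2 := pow_le_pow_left₀ (by positivity) h1 2
    have h3 : (1 / s ^ 2) ^ 2 = 1 / s ^ 4 := by rw [one_div_pow, ← pow_mul]
    rw [h3] at h2
    have h4 : 15 * ((n : ℝ) / x) ^ 2 ≤ 15 * (1 / s ^ 4) := mul_le_mul_of_nonneg_left h2 (by norm_num)
    calc 15 * ((n : ℝ) / x) ^ 2 ≤ 15 * (1 / s ^ 4) := h4
      _ = 15 / s ^ 4 := mul_one_div _ _)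
  -- `x^{1−β}`, `x^{−β}`
  have hlogx : Real.log x ≤ Lr := Real.log_le_log hx0 hxD
  have hlogx0 : 0 ≤ Real.log x := Real.log_nonneg hx1
  have htl : (1 - β) * Real.log x ≤ (1 - β) * Lr := mul_le_mul_of_nonneg_left hlogx ht0.le
  have htl1 : (1 - β) * Real.log x ≤ 1 := by linarith only [htl, htL]
  have htl0 : 0 ≤ (1 - β) * Real.log x := mul_nonneg ht0.le hlogx0
  have hxr : x ^ (1 - β) = Real.exp ((1 - β) * Real.log x) := by
    rw [Real.rpow_def_of_pos hx0, mul_comm]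
  have hxr1 : 1 ≤ x ^ (1 - β) := Real.one_le_rpow hx1 ht0.le
  have hxr2 : x ^ (1 - β) ≤ 1 + 2 * ((1 - β) * Real.log x) := by
    rw [hxr]
    have h := Real.abs_exp_sub_one_sub_id_le (x := (1 - β) * Real.log x)
      (by rw [abs_of_nonneg htl0]; exact htl1)
    have h' := (abs_le.mp h).2
    have ht2 : ((1 - β) * Real.log x) ^ 2 ≤ (1 - β) * Real.log x := by
      nlinarith only [htl0, htl1]
    linarith only [h', ht2]
  have hxre : x ^ (1 - β) ≤ Real.exp 1 := by
    rw [hxr]; exact Real.exp_le_exp.mpr htl1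
  have hxβ : x ^ (-β) ≤ Real.exp 1 / x := by
    rw [show -β = (1 - β) + (-1 : ℝ) by ring, Real.rpow_add hx0, Real.rpow_neg_one,
      ← div_eq_mul_inv]
    exact div_le_div_of_nonneg_right hxre hx0.le
  -- the error of the shifted line
  set Eint : ℂ := ∫ y : ℝ, hoffG χ β x (↑(-β) + y * I) with hEint
  have hεE : |720 / (2 * Real.pi) * Eint.re| ≤ 4320 * CE * (u ^ 2 / Lr) := by
    have h1 : |Eint.re| ≤ ‖Eint‖ := Complex.abs_re_le_norm Eint
    have h2 : ‖Eint‖ ≤ CE * (Real.sqrt D * (2 * Lr + 1)) * (Real.exp 1 / x) :=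
      hEn.trans (mul_le_mul_of_nonneg_left hxβ (by positivity))
    have h3 : CE * (Real.sqrt D * (2 * Lr + 1)) * (Real.exp 1 / x) =
        CE * (4 * Real.exp 1 * (2 * Lr + 1) / s ^ 4) := by
      rw [hx, hA]; field_simp
    have h720 : (0 : ℝ) < 720 / (2 * Real.pi) := by positivity
    rw [abs_mul, abs_of_pos h720]
    calc 720 / (2 * Real.pi) * |Eint.re| ≤ 720 / (2 * Real.pi) * (CE * (4 * Real.exp 1 *
        (2 * Lr + 1) / s ^ 4)) :=
          mul_le_mul_of_nonneg_left (h1.trans (h2.trans h3.le)) h720.le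
      _ ≤ 4320 * CE * (u ^ 2 / Lr) := hεnum
  -- `Π(β)`
  obtain ⟨hP1, hP2⟩ := pi_factor_bounds ht0.le ht20
  have hb3 : (0 : ℝ) < 2 + (1 - β) := by linarith only [hβ1]
  have hb4 : (0 : ℝ) < 3 + (1 - β) := by linarith only [hβ1]
  have hb5 : (0 : ℝ) < 4 + (1 - β) := by linarith only [hβ1]
  have hb6 : (0 : ℝ) < 5 + (1 - β) := by linarith only [hβ1]
  have hb7 : (0 : ℝ) < 6 + (1 - β) := by linarith only [hβ1]
  have hP0 : 0 < 720 / ((2 + (1 - β)) * (3 + (1 - β)) * (4 + (1 - β)) * (5 + (1 - β)) *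
      (6 + (1 - β))) :=
    div_pos (by norm_num) (mul_pos (mul_pos (mul_pos (mul_pos hb3 hb4) hb5) hb6) hb7)
  -- `(1−β)(Σ − E) = L(1) x^{1−β} Π`
  set SP := ∑ n ∈ Ioc 0 ⌊x⌋₊, charDivisorSum χ n * (n : ℝ) ^ (-β) * hoffPoly ((n : ℝ) / x)
    with hSP
  have hQ : (1 - β) * (SP - 720 / (2 * Real.pi) * Eint.re) =
      (χ.LFunction 1).re * x ^ (1 - β) *
        (720 / ((2 + (1 - β)) * (3 + (1 - β)) * (4 + (1 - β)) * (5 + (1 - β)) * (6 + (1 - β)))) := by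
    rw [hP, add_sub_cancel_right]
    have hb1 : (1 : ℝ) - β ≠ 0 := ht0.ne'
    have e3 : (2 : ℝ) + (1 - β) = 3 - β := by ring
    have e4 : (3 : ℝ) + (1 - β) = 4 - β := by ring
    have e5 : (4 : ℝ) + (1 - β) = 5 - β := by ring
    have e6 : (5 : ℝ) + (1 - β) = 6 - β := by ring
    have e7 : (6 : ℝ) + (1 - β) = 7 - β := by ring
    have hb3' : (3 : ℝ) - β ≠ 0 := by rw [← e3]; exact hb3.ne'
    have hb4' : (4 : ℝ) - β ≠ 0 := by rw [← e4]; exact hb4.ne'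
    have hb5' : (5 : ℝ) - β ≠ 0 := by rw [← e5]; exact hb5.ne'
    have hb6' : (6 : ℝ) - β ≠ 0 := by rw [← e6]; exact hb6.ne'
    have hb7' : (7 : ℝ) - β ≠ 0 := by rw [← e7]; exact hb7.ne'
    rw [e3, e4, e5, e6, e7]
    field_simp
  -- bounds for `Σ − E`
  have hpi : 1 ≤ Real.pi ^ 2 / 6 := by
    have h3 := Real.pi_gt_three
    rw [le_div_iff₀ (by norm_num)]; nlinarith only [h3]
  have hq6 : u ^ 2 / Lr ≤ 1 / 6 := by
    have : 3 * (u ^ 2 / Lr) ≤ (3 + 4320 * CE) * (u ^ 2 / Lr) :=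
      mul_le_mul_of_nonneg_right (by linarith only [hCE]) hq0
    linarith only [this, hδhalf]
  have hθ1 : 15 / s ^ 4 ≤ 1 := by linarith only [h15, hq6]
  have hQlo := main_lower hSPge hlowX' hεE hFS1 hpi (by positivity) hθ1 hV'0
  have hQhi := main_upper hSPle hupX hεE hFS1 hxr1 hpi hR0
  -- solve
  have hcFS : 0 < Real.pi ^ 2 / 6 * FS := by positivity
  have hδ₁0 : 0 ≤ 1 / (Nat.sqrt (⌊x'⌋₊ / M) : ℝ) + 15 / s ^ 4 + 4320 * CE * (u ^ 2 / Lr) := by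
    positivity
  have hδ₁ : 1 / (Nat.sqrt (⌊x'⌋₊ / M) : ℝ) + 15 / s ^ 4 + 4320 * CE * (u ^ 2 / Lr) ≤ 1 / 2 := by
    linarith only [hV', h15, hδhalf]
  have hδ₂0 : 0 ≤ 2 * ((Real.log (2 * x / ((M : ℝ) + 1)) + 16) / Real.log ((l : ℝ) / 2)) +
      ((M : ℝ) + 1) ^ (-(1 / Real.log l)) * Real.exp (2 * (Real.log (Real.log l) + K₀)) +
      4320 * CE * (u ^ 2 / Lr) :=
    add_nonneg (add_nonneg (mul_nonneg zero_le_two hW0) hR0) (by positivity)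
  have hmain := main_algebra ht0 hcFS hP0 hP1 hP2 hxr1 hxr2 htl0 htl1 hδ₁ hδ₁0 hδ₂0 hQ
    hQlo hQhi
  -- translate
  have hm : 6 / Real.pi ^ 2 * (χ.LFunction 1).re / FS =
      (χ.LFunction 1).re / (Real.pi ^ 2 / 6 * FS) := by
    field_simp
  rw [hm]
  refine hmain.trans ?_
  have hm0 : 0 ≤ (χ.LFunction 1).re / (Real.pi ^ 2 / 6 * FS) := by
    -- from `hQ`: `L(1) x^{1−β} Π = (1−β)(Σ − E) > 0`
    have hQ0 : 0 < SP - 720 / (2 * Real.pi) * Eint.re :=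
      lt_of_lt_of_le (mul_pos hcFS (by linarith only [hδ₁])) hQlo
    have hprod : 0 < (χ.LFunction 1).re * (x ^ (1 - β) * (720 / ((2 + (1 - β)) * (3 + (1 - β)) *
        (4 + (1 - β)) * (5 + (1 - β)) * (6 + (1 - β))))) := by
      rw [← mul_assoc, ← hQ]; exact mul_pos ht0 hQ0
    have hL1 : 0 < (χ.LFunction 1).re :=
      (mul_pos_iff_of_pos_right (mul_pos (by linarith only [hxr1]) hP0)).mp hprod
    positivity
  rw [mul_assoc ((χ.LFunction 1).re / (Real.pi ^ 2 / 6 * FS))]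
  refine mul_le_mul_of_nonneg_left ?_ hm0
  -- `2 tl + 6 δ₁ + 6 t + 6 δ₂ ≤ C (u²/L + t L)`
  have hδ₂ : 2 * ((Real.log (2 * x / ((M : ℝ) + 1)) + 16) / Real.log ((l : ℝ) / 2)) +
      ((M : ℝ) + 1) ^ (-(1 / Real.log l)) * Real.exp (2 * (Real.log (Real.log l) + K₀)) +
      4320 * CE * (u ^ 2 / Lr) ≤ (163 + Real.exp (2 * K₀) + 4320 * CE) * (u ^ 2 / Lr) := by
    linarith only [hW, hR.trans hRu, hq0]
  have hδ₁' : 1 / (Nat.sqrt (⌊x'⌋₊ / M) : ℝ) + 15 / s ^ 4 + 4320 * CE * (u ^ 2 / Lr) ≤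
      (163 + Real.exp (2 * K₀) + 4320 * CE) * (u ^ 2 / Lr) := by
    linarith only [hV', h15, hq0, heq0]
  have htt : (1 - β) ≤ (1 - β) * Lr := le_mul_of_one_le_right ht0.le hLr1
  have htLr0 : 0 ≤ (1 - β) * Lr := mul_nonneg ht0.le hLr0.le
  have hk1 : 0 ≤ Real.exp (2 * K₀) * ((1 - β) * Lr) := mul_nonneg (Real.exp_pos _).le htLr0
  have hk2 : 0 ≤ CE * ((1 - β) * Lr) := mul_nonneg hCE.le htLr0
  have hk3 : 0 ≤ CE * (u ^ 2 / Lr) := mul_nonneg hCE.le hq0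
  linarith only [hδ₂, hδ₁', htl, htt, hq0, heq0, htLr0, hk1, hk2, hk3]

end Literature.NumberTheory.LFunctions

end
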